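import Literature.Analysis.FluidPDE.LerayHopfFinalWeakSlice
import HarnessLib

/-!
# Route `FilamentSkeletonRss`, crux `RdssProfileTruncation` (stmt-NavierStokesRegularity-11289),
  line `Sketch` — stub `stub_lerayHopfFinalSlice` (Leray–Hopf up to the final time)

In the blow-up construction of the line the physical solution `w` is classical on `[0, T)` and
Leray–Hopf on every closed sub-slab `[0, T']`, `T' < T`; the crux conclusion needs
`IsLerayHopfOn T ν 0 u₀ ·` on `[0, T]` itself, whose fields see the slice at `T` (`L²`
membership, weak continuity on `(0, T]`, the energy inequalities for `t = T`). This stub redefines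
the slice at `T` as the weak `L²` limit of `w(t)`, `t → T⁻`, and is the specialisation to `ℝ³`
of the Literature theorem `exists_isLerayHopfOn_update_of_forall_lt`
(`Literature/Analysis/FluidPDE/LerayHopfFinalWeakSlice.lean`, with its tools file): the energy
inequality bounds `‖w(t)‖₂` uniformly; `w` is a weak solution on `[0, T)`, so its pairings with
divergence-free test fields have continuous models and hence limits at `T⁻`, the pairings with
test gradients vanish, and these generators span a dense subspace of `L²` (Helmholtz), whence a
weak limit `Y ∈ L²` by Riesz; the weak gradients of the slabs patch a.e. (uniqueness of weak
gradients) with finite total dissipation; the energy inequalities at `T` follow by weak lower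
semicontinuity and continuity from below of the dissipation (Leray 1934, §§31–33; Galdi 2000,
Def. 2.1, Lemma 2.2).
-/

noncomputable section

open MeasureTheory Set Filter Topology Function
open scoped RealInnerProductSpace ENNReal NNReal
open Literature.Analysis.FluidPDE

-- the prescribed summit-side namespace repeats `NavierStokesRegularity` (summit = problem name)
set_option linter.dupNamespace false

namespace Summit.NavierStokesRegularity.NavierStokesRegularity.Theorems

/-- Physical space `ℝ³`. -/
local notation "ℝ³" => EuclideanSpace ℝ (Fin 3)

/-- **stub_lerayHopfFinalSlice** (Leray–Hopf up to the final time). If `w` is a Leray–Hopf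
solution on every `[0, T')`, `0 < T' < T`, with viscosity `ν > 0` and datum `u₀`, then after
redefining the slice at `T` as the weak `L²` limit of `w(t)`, `t ↑ T`, `w` is Leray–Hopf on
`[0, T]`; the new field agrees with `w` on `[0, T)` (indeed off `t = T`). Specialisation of
`Literature.Analysis.FluidPDE.exists_isLerayHopfOn_update_of_forall_lt` to `ℝ³`
(Leray 1934, §31; Galdi 2000, Lemma 2.2). [cite: Galdi2000, Lemma 2.2] -/
theorem stub_lerayHopfFinalSlice :
    ∀ (T ν : ℝ) (u₀ : ℝ³ → ℝ³) (w : ℝ → ℝ³ → ℝ³), 0 < T → 0 < ν →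
      (∀ T' ∈ Ioo 0 T, IsLerayHopfOn T' ν 0 u₀ w) →
      ∃ w' : ℝ → ℝ³ → ℝ³, (∀ t ∈ Ico 0 T, w' t = w t) ∧ IsLerayHopfOn T ν 0 u₀ w' := by
  intro T ν u₀ w hT hν h
  obtain ⟨Y, -, hLH⟩ := exists_isLerayHopfOn_update_of_forall_lt hT hν h
  exact ⟨Function.update w T Y, fun t ht => Function.update_of_ne ht.2.ne Y w, hLH⟩

end Summit.NavierStokesRegularity.NavierStokesRegularity.Theorems
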